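import Summits.KontsevichZagierPeriods.KontsevichZagierPeriods.Theorems.SymplecticScissorsRealOnePeriodRelationsLoopLayer

/-!
# `RealOnePeriodRelations` (stmt-KontsevichZagierPeriods-10042), line `nash-retraction-thin-strip`,
# the log–loop layer: stub `stub_ratLoopArcs` — arcs of the joint layer are symbols

The log–loop layer joins the landed RATIONAL layer (logarithms; genus `0`, arbitrary paths) and the
landed LOOP layer (complete real elliptic integrals of a finite family `E_j : y² = x³ + A_j x + B_j` of
real elliptic curves over `ℚ̄ ∩ ℝ`; closed paths).  Its ARCS step says: every cell of the joint layer —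

* a unit rational cell `[∫_{(0,1)} P/Q]` (`Q ≠ 0` on `(0,1)`),
* a polynomial cell `[∫_{(a,b)} P]`,
* an odd oval cell `[∫_{(e₁,e₂)} (P₂ √f_j + P₃/√f_j)]` (`e₁ < e₂` consecutive real roots of `f_j`),
* a branch cell `[∫_{(e,∞)} c₀/√f_j]` (`e` the largest real root of `f_j`)

— is, modulo `M₁ = closure (1a ∪ 1b ∪ 2 ∪ Green)`, the sum of the real realisations of an algebraic
combination `C` of period symbols with the same value, every symbol in the support of `C` being either a
symbol on a punctured line `Z_a = {y ∏ (x − aᵢ) = 1}`, or the unit symbol `𝟙`, or a CLOSED-loop symbol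
on one of the curves `E_j`.

This is a plain four-way case split repackaging the two landed arcs theorems:
`RationalLayer.ratArcs` (unit rational cells ↦ punctured-line symbols) and `LoopLayer.stub_loopArcs`
(polynomial / odd-oval / branch cells ↦ unit and closed-loop symbols); the only work is widening the
disjunction describing the support of `C`.

References: A. Huber, G. Wüstholz, *Transcendence and Linear Relations of 1-Periods* (2022), §3.3.1,
§13.2; M. Kontsevich, D. Zagier, *Periods* (2001), §1.2.
-/

noncomputable section

open scoped BigOperators Polynomial
open Set MeasureTheory MvPolynomial
open Literature.NumberTheory.Transcendental Literature.NumberTheory.Transcendental.CurvePeriods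
open Summit.KontsevichZagierPeriods.SymplecticScissors.RealOnePeriodRelationsNegative (M₁ H₁ crux_iff unitDom)

namespace Summit.KontsevichZagierPeriods.SymplecticScissors.RealOnePeriodRelations

namespace LogLoopLayer

/-- **Stub `stub_ratLoopArcs`** (registered) — ARCS ARE SYMBOLS on the log–loop layer: a unit rational
cell is, modulo `M₁`, the real realisation of a period symbol on a punctured line
(`RationalLayer.ratArcs`), a polynomial / odd-oval / branch cell that of an algebraic combination of the
unit symbol and closed-loop symbols on `y² = x³ + A_j x + B_j` (`LoopLayer.stub_loopArcs`), with the
same value. [cite: HuberWustholz2022, §3.3.1, §13.2] -/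
theorem stub_ratLoopArcs : ∀ (k : ℕ) (A B : Fin k → ℝ), (∀ j, IsAlgebraic ℚ (A j)) → (∀ j, IsAlgebraic ℚ (B j)) →
    (∀ j, 4 * A j ^ 3 + 27 * B j ^ 2 ≠ 0) →
    ∀ ρ : KZ.IntegralRep 1,
    ((ρ.domain = {z | z 0 ∈ Set.Ioo (0 : ℝ) 1} ∧
        ∃ P Q : Polynomial (algebraicClosure ℚ ℝ),
          (∀ t ∈ Set.Ioo (0 : ℝ) 1, Polynomial.aeval t Q ≠ 0) ∧
          ∀ t ∈ Set.Ioo (0 : ℝ) 1, ρ.integrand (fun _ => t) = Polynomial.aeval t P / Polynomial.aeval t Q) ∨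
      (∃ a b : ℝ, IsAlgebraic ℚ a ∧ IsAlgebraic ℚ b ∧ a < b ∧ ρ.domain = {z | z 0 ∈ Set.Ioo a b} ∧
            ∃ P : Polynomial (algebraicClosure ℚ ℝ), ∀ x ∈ Set.Ioo a b, ρ.integrand (fun _ => x) = Polynomial.aeval x P) ∨
        (∃ j, ∃ e₁ e₂ : ℝ, IsAlgebraic ℚ e₁ ∧ IsAlgebraic ℚ e₂ ∧ e₁ < e₂ ∧ e₁ ^ 3 + A j * e₁ + B j = 0 ∧
          e₂ ^ 3 + A j * e₂ + B j = 0 ∧ (∀ x ∈ Set.Ioo e₁ e₂, 0 < x ^ 3 + A j * x + B j) ∧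
          ρ.domain = {z | z 0 ∈ Set.Ioo e₁ e₂} ∧
          ∃ P₂ P₃ : Polynomial (algebraicClosure ℚ ℝ), ∀ x ∈ Set.Ioo e₁ e₂,
            ρ.integrand (fun _ => x) = Polynomial.aeval x P₂ * Real.sqrt (x ^ 3 + A j * x + B j) +
              Polynomial.aeval x P₃ / Real.sqrt (x ^ 3 + A j * x + B j)) ∨
        (∃ j, ∃ e c₀ : ℝ, IsAlgebraic ℚ e ∧ IsAlgebraic ℚ c₀ ∧ e ^ 3 + A j * e + B j = 0 ∧
          (∀ x : ℝ, e < x → 0 < x ^ 3 + A j * x + B j) ∧ ρ.domain = {z | e < z 0} ∧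
          ∀ z ∈ ρ.domain, ρ.integrand z = c₀ / Real.sqrt ((z 0) ^ 3 + A j * (z 0) + B j))) →
    ∃ (C : PeriodSymbol →₀ ℂ) (R : PeriodSymbol → KZ.IntegralRep 1), (∀ s, IsAlgebraic ℚ (C s)) ∧
      (∀ s ∈ C.support,
        (∃ (r : ℕ) (a : Fin r → ℂ), Function.Injective a ∧ (∀ i, IsAlgebraic ℚ (a i)) ∧
          s.Z = (⟨2, 1, ![X 1 * ∏ i, (X 0 - MvPolynomial.C (a i)) - 1]⟩ : CurveData)) ∨
        s = PeriodSymbol.unit ∨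
        ∃ j, s.Z = weierCurve (A j : ℂ) (B j : ℂ) ∧ s.γ.toFun 1 = s.γ.toFun 0) ∧
      (∀ s ∈ C.support, IsSemialgebraicMapOn ℚ {z : Fin 1 → ℝ | z 0 ∈ Set.Icc (0 : ℝ) 1}
        (fun z => Fin.append (fun i => (s.γ.toFun (z 0) i).re) (fun i => (s.γ.toFun (z 0) i).im))) ∧
      (∀ s ∈ C.support, (R s).domain = {z | z 0 ∈ Set.Ioo (0 : ℝ) 1} ∧ ∀ z ∈ (R s).domain, (R s).integrand z =
        (C s * ∑ i, MvPolynomial.eval (s.γ.toFun (z 0)) (s.ω i) * deriv (fun u => s.γ.toFun u i) (z 0)).re) ∧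
      evalCombination C = ((ρ.value : ℝ) : ℂ) ∧ KZ.of ρ - ∑ s ∈ C.support, KZ.of (R s) ∈ M₁ := by
  intro k A B hA hB hD ρ hρ
  rcases hρ with hrat | hloop
  · obtain ⟨C, R, h1, h2, h3, h4, h5, h6⟩ := RationalLayer.ratArcs ρ hrat
    exact ⟨C, R, h1, fun s hs => Or.inl (h2 s hs), h3, h4, h5, h6⟩
  · obtain ⟨C, R, h1, h2, h3, h4, h5, h6⟩ := LoopLayer.stub_loopArcs k A B hA hB hD ρ hloop
    exact ⟨C, R, h1, fun s hs => Or.inr (h2 s hs), h3, h4, h5, h6⟩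

end LogLoopLayer

end Summit.KontsevichZagierPeriods.SymplecticScissors.RealOnePeriodRelations

end
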